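import Mathlib
import HarnessLib
import Literature.MathematicalPhysics.QuantumLattice.HubbardGridCharacters
import Literature.MathematicalPhysics.QuantumLattice.GrassmannChargeScaling
import Literature.MathematicalPhysics.QuantumLattice.GrassmannRelabelling
import Literature.MathematicalPhysics.QuantumLattice.GrassmannLinearSubstitution

/-!
# Route `KLProgramme` — ENGINE child `KLRegimeEngineV16` (stmt-HubbardSuperconductivity-20236): the TWISTED TRANSLATION INVARIANCE of the
# grid effective action `effAction (Sᵀ·normalCovariance p·S) V_U` on the `N`-point time grid (cell gate-hubbard-kl, seat hubbard-kl-k3c5-p2 g6,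
# β′ lane — hypothesis (r2) `hrow` of the two-volume read-out `…TwoVolumeGridReadout` / `…ResummedReadout`)

On the space–time grid `GridPoint L N = Fin N × (ℤ/L)²` with times `τ_j = jβ/N ∈ [0, β)` the position–time fields
`ψ^c_{(j,x⃗),σ} = (βL²)⁻¹Σ_k conj(e^{−is_c(ω τ_j + p_k⃗·x⃗)}) ψ̂^c_{kσ}` (`hubbardGridSub`) are ANTIPERIODIC in time: a shift `j ↦ j + s` that wraps
around `N` changes `τ` by `τ_s − β` and `e^{iωβ} = −1` for fermionic `ω`.  Hence the pulled-back covariance `C_g = Sᵀ·normalCovariance p·S`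
of ANY normal symbol `p` is invariant under the SIGNED shift `ψ(X) ↦ ε_s(X)·ψ(X + t)`, `t = (s, a⃗)`, `ε_s(X) = −1` iff the time of `X` wraps
(`gridCov_shift_apply`), the ultralocal quartic `V_U = U ε Σ_p ψ⁺↑ψ⁻↑ψ⁺↓ψ⁻↓(p)` is invariant (four equal signs), and therefore so is the
effective action ([tree] `effAction_map_mulLeft'` ∘ `effAction_map_funLeft`): its kernels satisfy
`kernel W m (X + t) = (∏ᵢ ε_s(Xᵢ))·kernel W m X` (`kernel_gridEffAction_shift`).  For the two-leg `(+,−)` string the phase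
`e^{iω(τ_{j₀} − τ_{j₁})}` picks up exactly the same two signs under the shift (`exp_matsubara_gridTime_shift`), so the PHASE-WEIGHTED ROWS
`R(p₀,y) = Σ_{p₁ : x⃗₁ = x⃗₀ + y} e^{iω(τ_{p₀} − τ_{p₁})}·kernel W 2 ((p₀,σ,+),(p₁,σ,−))` do not depend on the base point
(**`gridEffAction_row_eq_row`** — hypothesis `hrow` of the β′ read-out, for every normal symbol, in particular the K-resummed one).

Proofs only; no definitions (shift `Equiv.prodCongr (Equiv.prodCongr (Equiv.addRight t) 1) 1` and sign written inline); nothing about bounds.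
References: BGM 2006 §2.1 (2.2)–(2.5) (antiperiodic Grassmann fields); Salmhofer 1999 §4.2.4 (4.55)–(4.63) (the time lattice).
-/

noncomputable section

namespace Summit.HubbardSuperconductivity.HubbardSuperconductivity.Theorems.TwoVolumeDefect

set_option linter.dupNamespace false -- summit = problem name (single-conjunct summit), D-0017

open Finset Complex Literature.MathematicalPhysics.QuantumLattice Literature.Probability.LatticeModels GrassmannAlgebra
open scoped ComplexConjugate

variable {L M N : ℕ} [NeZero L] [NeZero N]

/-! ## §1 Grid times under a shift; the fermionic sign -/

omit [NeZero L] [NeZero N] in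
/-- `(j + s).val = j.val + s.val` or `j.val + s.val − N` according as the shift wraps. -/
theorem val_add_eq_ite (j s : Fin N) : ((j + s : Fin N).val : ℝ) = (j.val : ℝ) + s.val - (if j.val + s.val < N then 0 else (N : ℝ)) := by
  rw [Fin.val_add]
  split_ifs with h
  · rw [Nat.mod_eq_of_lt h]; push_cast; ring
  · have h2 : j.val + s.val - N < N := by have := j.isLt; have := s.isLt; omega
    rw [show (j.val + s.val) % N = j.val + s.val - N by
      rw [Nat.mod_eq_sub_mod (by omega), Nat.mod_eq_of_lt h2]]
    have : N ≤ j.val + s.val := by omega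
    push_cast [Nat.cast_sub this]
    ring

omit [NeZero L] in
/-- **Grid times under a shift**: `τ_{j+s} = τ_j + τ_s − β·[wrap]`. -/
theorem gridTime_add (β : ℝ) (j s : Fin N) :
    gridTime β N (j + s) = gridTime β N j + gridTime β N s - (if j.val + s.val < N then 0 else β) := by
  have hN : (N : ℝ) ≠ 0 := by exact_mod_cast NeZero.ne N
  simp only [gridTime]
  rw [val_add_eq_ite]
  split_ifs
  · field_simp
    ring
  · field_simp

omit [NeZero L] [NeZero N] in
/-- `e^{iωβ} = −1` for a fermionic Matsubara frequency (`β ≠ 0`). -/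
theorem exp_matsubaraFreq_mul_beta {β : ℝ} (hβ : β ≠ 0) (n : MatsubaraIdx M) :
    Complex.exp (((matsubaraFreq β M n * β : ℝ) : ℂ) * Complex.I) = -1 := by
  have h : matsubaraFreq β M n * β = Real.pi * (2 * (matsubaraInt M n : ℝ) + 1) := by
    rw [matsubaraFreq]; field_simp
  rw [h]
  push_cast
  rw [show (Real.pi : ℂ) * (2 * (matsubaraInt M n : ℂ) + 1) * Complex.I =
      (matsubaraInt M n : ℂ) * (2 * Real.pi * Complex.I) + Real.pi * Complex.I by ring,
    Complex.exp_add, Complex.exp_int_mul_two_pi_mul_I, one_mul, Complex.exp_pi_mul_I]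

omit [NeZero L] in
/-- **The two-leg phase under a common shift of both times picks up the two fermionic signs**:
`e^{iω(τ_{j+s} − τ_{j'+s})} = ε_s(j)·ε_s(j')·e^{iω(τ_j − τ_{j'})}`, `ε_s(j) = 1` if `j + s < N` else `−1`. -/
theorem exp_matsubara_gridTime_shift {β : ℝ} (hβ : β ≠ 0) (n : MatsubaraIdx M) (j j' s : Fin N) :
    Complex.exp (((matsubaraFreq β M n * (gridTime β N (j + s) - gridTime β N (j' + s)) : ℝ) : ℂ) * Complex.I) =
      (if j.val + s.val < N then (1 : ℂ) else -1) * (if j'.val + s.val < N then (1 : ℂ) else -1) *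
        Complex.exp (((matsubaraFreq β M n * (gridTime β N j - gridTime β N j') : ℝ) : ℂ) * Complex.I) := by
  have hm1 := exp_matsubaraFreq_mul_beta hβ n
  rw [gridTime_add, gridTime_add]
  split_ifs with h1 h2 h2
  · rw [one_mul, one_mul]; congr 1; push_cast; ring
  · -- j' wraps: phase gains `+ωβ`
    rw [show ((matsubaraFreq β M n * (gridTime β N j + gridTime β N s - 0 - (gridTime β N j' + gridTime β N s - β)) : ℝ) : ℂ) * Complex.I =
        ((matsubaraFreq β M n * (gridTime β N j - gridTime β N j') : ℝ) : ℂ) * Complex.I +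
          ((matsubaraFreq β M n * β : ℝ) : ℂ) * Complex.I by push_cast; ring, Complex.exp_add, hm1]
    ring
  · rw [show ((matsubaraFreq β M n * (gridTime β N j + gridTime β N s - β - (gridTime β N j' + gridTime β N s - 0)) : ℝ) : ℂ) * Complex.I =
        ((matsubaraFreq β M n * (gridTime β N j - gridTime β N j') : ℝ) : ℂ) * Complex.I -
          ((matsubaraFreq β M n * β : ℝ) : ℂ) * Complex.I by push_cast; ring, Complex.exp_sub, hm1]
    ring
  · rw [show ((matsubaraFreq β M n * (gridTime β N j + gridTime β N s - β - (gridTime β N j' + gridTime β N s - β)) : ℝ) : ℂ) * Complex.I =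
        ((matsubaraFreq β M n * (gridTime β N j - gridTime β N j') : ℝ) : ℂ) * Complex.I by push_cast; ring]
    ring

omit [NeZero L] [NeZero N] in
/-- `e^{iπ(1−2M)} = −1`. -/
theorem exp_pi_mul_one_sub_two_mul : Complex.exp (((Real.pi * (1 - 2 * (M : ℝ)) : ℝ) : ℂ) * Complex.I) = -1 := by
  have h : ((Real.pi * (1 - 2 * (M : ℝ)) : ℝ) : ℂ) * Complex.I =
      (((-(M : ℤ)) : ℤ) : ℂ) * (2 * Real.pi * Complex.I) + Real.pi * Complex.I := by
    push_cast
    ring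
  rw [h, Complex.exp_add, Complex.exp_int_mul_two_pi_mul_I, one_mul, Complex.exp_pi_mul_I]

omit [NeZero L] in
/-- **The chronological prefactor under a common shift**: `e^{iπ(1−2M)((j+s) − (j'+s))/N} = ε_s(j)ε_s(j')·e^{iπ(1−2M)(j − j')/N}`
(plain integer differences of the representatives). -/
theorem exp_prefactor_shift (j j' s : Fin N) :
    Complex.exp (((Real.pi * (1 - 2 * (M : ℝ)) * ((((j + s : Fin N) : ℕ) : ℝ) - (((j' + s : Fin N) : ℕ) : ℝ)) / N : ℝ) : ℂ) * Complex.I) =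
      (if j.val + s.val < N then (1 : ℂ) else -1) * (if j'.val + s.val < N then (1 : ℂ) else -1) *
        Complex.exp (((Real.pi * (1 - 2 * (M : ℝ)) * (((j : ℕ) : ℝ) - ((j' : ℕ) : ℝ)) / N : ℝ) : ℂ) * Complex.I) := by
  have hN : (N : ℝ) ≠ 0 := by exact_mod_cast NeZero.ne N
  have hNc : (N : ℂ) ≠ 0 := by exact_mod_cast NeZero.ne N
  have hm1 := exp_pi_mul_one_sub_two_mul (M := M)
  have hv := val_add_eq_ite j s
  have hv' := val_add_eq_ite j' s
  rw [show (((j + s : Fin N) : ℕ) : ℝ) = ((j + s : Fin N).val : ℝ) from rfl, show (((j' + s : Fin N) : ℕ) : ℝ) = ((j' + s : Fin N).val : ℝ) from rfl,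
    hv, hv']
  split_ifs with h1 h2 h2
  · rw [one_mul, one_mul]; congr 1; push_cast; ring
  · rw [show ((Real.pi * (1 - 2 * (M : ℝ)) * ((j.val : ℝ) + s.val - 0 - ((j'.val : ℝ) + s.val - N)) / N : ℝ) : ℂ) * Complex.I =
        ((Real.pi * (1 - 2 * (M : ℝ)) * (((j : ℕ) : ℝ) - ((j' : ℕ) : ℝ)) / N : ℝ) : ℂ) * Complex.I +
          ((Real.pi * (1 - 2 * (M : ℝ)) : ℝ) : ℂ) * Complex.I by push_cast; field_simp; ring, Complex.exp_add, hm1]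
    ring
  · rw [show ((Real.pi * (1 - 2 * (M : ℝ)) * ((j.val : ℝ) + s.val - N - ((j'.val : ℝ) + s.val - 0)) / N : ℝ) : ℂ) * Complex.I =
        ((Real.pi * (1 - 2 * (M : ℝ)) * (((j : ℕ) : ℝ) - ((j' : ℕ) : ℝ)) / N : ℝ) : ℂ) * Complex.I -
          ((Real.pi * (1 - 2 * (M : ℝ)) : ℝ) : ℂ) * Complex.I by push_cast; field_simp; ring, Complex.exp_sub, hm1]
    ring
  · push_cast; ring

/-! ## §2 The pulled-back normal covariance is invariant under the signed shift -/

omit [NeZero L] [NeZero N] in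
/-- Residues of shifted times: `↑(j + s) − ↑(j' + s) = ↑j − ↑j'` in `ℤ/N`. -/
theorem natCast_val_add_sub (j j' s : Fin N) :
    ((((j + s : Fin N) : ℕ) : ZMod N) - (((j' + s : Fin N) : ℕ) : ZMod N)) = (((j : ℕ) : ZMod N) - ((j' : ℕ) : ZMod N)) := by
  have h : ∀ a : Fin N, (((a + s : Fin N) : ℕ) : ZMod N) = ((a : ℕ) : ZMod N) + ((s : ℕ) : ZMod N) := by
    intro a
    rw [Fin.val_add, ZMod.natCast_mod, Nat.cast_add]
  rw [h j, h j']
  ring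

/-- **Twisted translation invariance of `C_g = Sᵀ·normalCovariance p·S`** (`S = hubbardGridSub L M β N`, `2M ≤ N`, `β ≠ 0`): for the shift
`X ↦ X + t`, `t = (s, a⃗)` of the grid point (spin and charge fixed), `C_g (X + t) (Y + t) = ε_s(X)·ε_s(Y)·C_g X Y`. -/
theorem gridCov_shift_apply {β : ℝ} (hβ : β ≠ 0) (hN : 2 * M ≤ N) (p : FreqMomentum L M × Fin 2 → ℂ) (t : GridPoint L N)
    (X Y : GridLeg (GridPoint L N)) :
    ((hubbardGridSub L M β N).transpose * normalCovariance L M p * hubbardGridSub L M β N)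
        (((X.1.1 + t, X.1.2), X.2)) (((Y.1.1 + t, Y.1.2), Y.2)) =
      (if X.1.1.1.val + t.1.val < N then (1 : ℂ) else -1) * (if Y.1.1.1.val + t.1.val < N then (1 : ℂ) else -1) *
        ((hubbardGridSub L M β N).transpose * normalCovariance L M p * hubbardGridSub L M β N) X Y := by
  obtain ⟨⟨⟨j, x⟩, σ⟩, c⟩ := X
  obtain ⟨⟨⟨j', x'⟩, σ'⟩, c'⟩ := Y
  obtain ⟨s, a⟩ := t
  -- the (+,−) entries at equal spin, as a function of the base data
  have h01 : ∀ (j j' : Fin N) (x x' : TorusSite 2 L) (σ σ' : Fin 2),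
      ((hubbardGridSub L M β N).transpose * normalCovariance L M p * hubbardGridSub L M β N) (((j + s, x + a), σ), 0) (((j' + s, x' + a), σ'), 1) =
        (if j.val + s.val < N then (1 : ℂ) else -1) * (if j'.val + s.val < N then (1 : ℂ) else -1) *
          ((hubbardGridSub L M β N).transpose * normalCovariance L M p * hubbardGridSub L M β N) (((j, x), σ), 0) (((j', x'), σ'), 1) := by
    intro j j' x x' σ σ'
    by_cases hσ : σ = σ'
    · subst hσ
      rw [gridSub_pullback_apply_zero_one_eq_charSum hβ hN, gridSub_pullback_apply_zero_one_eq_charSum hβ hN, exp_prefactor_shift,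
        natCast_val_add_sub, show x + a - (x' + a) = x - x' by abel]
      ring
    · rw [hubbardGridSub, gridSub_pullback_normalCovariance_apply_zero_one, if_neg hσ, gridSub_pullback_normalCovariance_apply_zero_one,
        if_neg hσ, mul_zero]
  have h00 : ∀ (P Q : GridPoint L N × Fin 2) (c : Fin 2),
      ((hubbardGridSub L M β N).transpose * normalCovariance L M p * hubbardGridSub L M β N) (P, c) (Q, c) = 0 := by
    intro P Q c
    rw [hubbardGridSub]
    exact gridSub_pullback_normalCovariance_apply_of_charge_eq _ _ _ _ rfl
  have h10 : ∀ (P Q : GridPoint L N × Fin 2),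
      ((hubbardGridSub L M β N).transpose * normalCovariance L M p * hubbardGridSub L M β N) (P, 1) (Q, 0) =
        -((hubbardGridSub L M β N).transpose * normalCovariance L M p * hubbardGridSub L M β N) (Q, 0) (P, 1) := by
    intro P Q
    obtain ⟨a1, s1⟩ := P
    obtain ⟨b1, s2⟩ := Q
    rw [hubbardGridSub]
    exact gridSub_pullback_normalCovariance_apply_one_zero _ _ _ _ _ _ _ _
  dsimp only
  simp only [Prod.mk_add_mk]
  fin_cases c <;> fin_cases c'
  · -- (+,+)
    simp only [Fin.zero_eta, Fin.isValue]
    rw [h00, h00, mul_zero]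
  · -- (+,−)
    simp only [Fin.zero_eta, Fin.isValue, Fin.mk_one]
    exact h01 j j' x x' σ σ'
  · -- (−,+)
    simp only [Fin.zero_eta, Fin.isValue, Fin.mk_one]
    rw [h10, h10, h01 j' j x' x σ' σ]
    ring
  · -- (−,−)
    simp only [Fin.isValue, Fin.mk_one]
    rw [h00, h00, mul_zero]

/-! ## §3 The quartic grid interaction is invariant under the signed shift -/

omit [NeZero L] in
/-- The relabelling by the shift sends the grid word at `p` to the grid word at `p + t`. -/
theorem map_funLeft_shift_gridWord (t : GridPoint L N) (p : GridPoint L N) :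
    ExteriorAlgebra.map (LinearMap.funLeft ℂ ℂ
        (Equiv.prodCongr (Equiv.prodCongr (Equiv.addRight t) (Equiv.refl (Fin 2))) (Equiv.refl (Fin 2)) :
          GridLeg (GridPoint L N) ≃ GridLeg (GridPoint L N)).symm) (gridWord L N p) = gridWord L N (p + t) := by
  simp only [gridWord, map_mul, map_funLeft_gen]
  rfl

omit [NeZero L] [NeZero N] in
/-- A sign depending only on the grid point's time acts trivially on a grid word (four equal factors `±1`). -/
theorem map_mulLeft_timeSign_gridWord (s : Fin N) (q : GridPoint L N) :
    ExteriorAlgebra.map (LinearMap.mulLeft ℂ (fun Y : GridLeg (GridPoint L N) => if s.val ≤ Y.1.1.1.val then (1 : ℂ) else -1))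
      (gridWord L N q) = gridWord L N q := by
  simp only [gridWord, map_mul, map_mulLeft_gen]
  split_ifs <;> simp

/-- **`V_U` is invariant under the signed shift** `ψ(X) ↦ ε·ψ(X + t)`. -/
theorem signedShift_hubbardGridInteraction (β U : ℝ) (t : GridPoint L N) :
    ExteriorAlgebra.map (LinearMap.mulLeft ℂ (fun Y : GridLeg (GridPoint L N) => if t.1.val ≤ Y.1.1.1.val then (1 : ℂ) else -1))
      (ExteriorAlgebra.map (LinearMap.funLeft ℂ ℂ
        (Equiv.prodCongr (Equiv.prodCongr (Equiv.addRight t) (Equiv.refl (Fin 2))) (Equiv.refl (Fin 2)) :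
          GridLeg (GridPoint L N) ≃ GridLeg (GridPoint L N)).symm) (hubbardGridInteraction L N β U)) =
      hubbardGridInteraction L N β U := by
  simp only [hubbardGridInteraction, map_smul, map_sum, map_funLeft_shift_gridWord, map_mulLeft_timeSign_gridWord]
  congr 1
  exact Fintype.sum_equiv (Equiv.addRight t) _ _ fun p => rfl

/-! ## §4 The effective action and its kernels -/

omit [NeZero L] [NeZero N] in
/-- The sign after the shift is the wrap indicator before it: for `Y = X + t`, `[t.time ≤ time Y] = [time X + t.time < N]`. -/
theorem timeSign_shift (t : GridPoint L N) (X : GridLeg (GridPoint L N)) :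
    (if t.1.val ≤ (X.1.1.1 + t.1 : Fin N).val then (1 : ℂ) else -1) = (if X.1.1.1.val + t.1.val < N then (1 : ℂ) else -1) := by
  have hv : ((X.1.1.1 + t.1 : Fin N).val : ℝ) = (X.1.1.1.val : ℝ) + t.1.val - (if X.1.1.1.val + t.1.val < N then 0 else (N : ℝ)) :=
    val_add_eq_ite X.1.1.1 t.1
  by_cases h : X.1.1.1.val + t.1.val < N
  · rw [if_pos h] at hv ⊢
    rw [if_pos]
    have : ((X.1.1.1 + t.1 : Fin N).val : ℝ) = X.1.1.1.val + t.1.val := by rw [hv]; ring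
    have : (X.1.1.1 + t.1 : Fin N).val = X.1.1.1.val + t.1.val := by exact_mod_cast this
    omega
  · rw [if_neg h] at hv ⊢
    rw [if_neg]
    have h2 : ((X.1.1.1 + t.1 : Fin N).val : ℝ) + N = X.1.1.1.val + t.1.val := by rw [hv]; ring
    have h3 : (X.1.1.1 + t.1 : Fin N).val + N = X.1.1.1.val + t.1.val := by exact_mod_cast h2
    have := X.1.1.1.isLt
    omega

/-- **The grid effective action is invariant under the signed shift**: for `W = effAction C_g V_U`,
`W = S_ε (W ∘ shift)` with `S_ε` the sign scaling (`2M ≤ N`, `β ≠ 0`). -/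
theorem signedShift_gridEffAction {β : ℝ} (hβ : β ≠ 0) (hN : 2 * M ≤ N) (p : FreqMomentum L M × Fin 2 → ℂ) (U : ℝ) (t : GridPoint L N) :
    ExteriorAlgebra.map (LinearMap.mulLeft ℂ (fun Y : GridLeg (GridPoint L N) => if t.1.val ≤ Y.1.1.1.val then (1 : ℂ) else -1))
      (ExteriorAlgebra.map (LinearMap.funLeft ℂ ℂ
        (Equiv.prodCongr (Equiv.prodCongr (Equiv.addRight t) (Equiv.refl (Fin 2))) (Equiv.refl (Fin 2)) :
          GridLeg (GridPoint L N) ≃ GridLeg (GridPoint L N)).symm)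
        (effAction ℂ ((hubbardGridSub L M β N).transpose * normalCovariance L M p * hubbardGridSub L M β N) (hubbardGridInteraction L N β U))) =
      effAction ℂ ((hubbardGridSub L M β N).transpose * normalCovariance L M p * hubbardGridSub L M β N) (hubbardGridInteraction L N β U) := by
  set Cg := (hubbardGridSub L M β N).transpose * normalCovariance L M p * hubbardGridSub L M β N with hCg
  set e : GridLeg (GridPoint L N) ≃ GridLeg (GridPoint L N) :=
    Equiv.prodCongr (Equiv.prodCongr (Equiv.addRight t) (Equiv.refl (Fin 2))) (Equiv.refl (Fin 2)) with he
  set c : GridLeg (GridPoint L N) → ℂ := fun Y => if t.1.val ≤ Y.1.1.1.val then (1 : ℂ) else -1 with hc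
  have hV := signedShift_hubbardGridInteraction (L := L) β U t
  -- the pulled-back covariance of the composite substitution is `Cg` again
  have hcov : (Matrix.of fun X Y => c X * c Y * Cg X Y).submatrix e e = Cg := by
    ext X Y
    rw [Matrix.submatrix_apply, Matrix.of_apply]
    have he' : ∀ Z : GridLeg (GridPoint L N), e Z = (((Z.1.1 + t, Z.1.2), Z.2)) := fun Z => rfl
    rw [he', he', hCg, gridCov_shift_apply hβ hN p t X Y]
    show c (((X.1.1 + t, X.1.2), X.2)) * c (((Y.1.1 + t, Y.1.2), Y.2)) * _ = _
    rw [hc]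
    dsimp only
    rw [show (X.1.1 + t).1 = X.1.1.1 + t.1 from rfl, show (Y.1.1 + t).1 = Y.1.1.1 + t.1 from rfl, timeSign_shift t X, timeSign_shift t Y]
    have h1 : ∀ P : Prop, ∀ [Decidable P], ((if P then (1 : ℂ) else -1) * (if P then (1 : ℂ) else -1)) = 1 := by
      intro P _; split_ifs <;> norm_num
    calc (if X.1.1.1.val + t.1.val < N then (1 : ℂ) else -1) * (if Y.1.1.1.val + t.1.val < N then (1 : ℂ) else -1) *
          ((if X.1.1.1.val + t.1.val < N then (1 : ℂ) else -1) * (if Y.1.1.1.val + t.1.val < N then (1 : ℂ) else -1) * Cg X Y)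
        = ((if X.1.1.1.val + t.1.val < N then (1 : ℂ) else -1) * (if X.1.1.1.val + t.1.val < N then (1 : ℂ) else -1)) *
          ((if Y.1.1.1.val + t.1.val < N then (1 : ℂ) else -1) * (if Y.1.1.1.val + t.1.val < N then (1 : ℂ) else -1)) * Cg X Y := by ring
      _ = Cg X Y := by rw [h1, h1, one_mul, one_mul]
  conv_rhs => rw [← hV]
  rw [effAction_map_mulLeft', effAction_map_funLeft, hcov]

/-- **Kernels of the grid effective action under the shift**: `kernel W m (X + t) = (∏ᵢ ε_t(Xᵢ))·kernel W m X`. -/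
theorem kernel_gridEffAction_shift {β : ℝ} (hβ : β ≠ 0) (hN : 2 * M ≤ N) (p : FreqMomentum L M × Fin 2 → ℂ) (U : ℝ) (t : GridPoint L N)
    (m : ℕ) (X : Fin m → GridLeg (GridPoint L N)) :
    kernel ℂ (effAction ℂ ((hubbardGridSub L M β N).transpose * normalCovariance L M p * hubbardGridSub L M β N) (hubbardGridInteraction L N β U)) m
        (fun i => (((X i).1.1 + t, (X i).1.2), (X i).2)) =
      (∏ i, (if (X i).1.1.1.val + t.1.val < N then (1 : ℂ) else -1)) *
        kernel ℂ (effAction ℂ ((hubbardGridSub L M β N).transpose * normalCovariance L M p * hubbardGridSub L M β N) (hubbardGridInteraction L N β U))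
          m X := by
  set W := effAction ℂ ((hubbardGridSub L M β N).transpose * normalCovariance L M p * hubbardGridSub L M β N) (hubbardGridInteraction L N β U)
    with hW
  set e : GridLeg (GridPoint L N) ≃ GridLeg (GridPoint L N) :=
    Equiv.prodCongr (Equiv.prodCongr (Equiv.addRight t) (Equiv.refl (Fin 2))) (Equiv.refl (Fin 2)) with he
  have hinv := signedShift_gridEffAction hβ hN p U t
  rw [← hW] at hinv
  have hX : (fun i => (((X i).1.1 + t, (X i).1.2), (X i).2)) = e ∘ X := by funext i; rfl
  rw [hX]
  conv_lhs => rw [← hinv]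
  rw [kernel_map_mulLeft, kernel_map_funLeft]
  have hcomp : e.symm ∘ (e ∘ X) = X := by funext i; simp
  rw [hcomp]
  congr 1
  refine Finset.prod_congr rfl fun i _ => ?_
  exact timeSign_shift t (X i)

/-! ## §5 Base-point independence of the phase-weighted two-leg rows (hypothesis `hrow` of the β′ read-out) -/

/-- **The phase-weighted `(+,−)` rows of the grid effective action do not depend on the base point.**  For `W = effAction C_g V_U`
(`C_g = Sᵀ·normalCovariance p·S`, any normal symbol `p`, `2M ≤ N`, `β ≠ 0`), every frequency index `n`, spin `σ`, base points `p₀, o` and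
spatial offset `y`:
`Σ_{p₁ : x⃗_{p₁} = x⃗_{p₀} + y} e^{iω_n(τ_{p₀} − τ_{p₁})} W₂((p₀,σ,+),(p₁,σ,−)) = Σ_{p₁ : x⃗_{p₁} = x⃗_o + y} e^{iω_n(τ_o − τ_{p₁})} W₂((o,σ,+),(p₁,σ,−))`. -/
theorem gridEffAction_row_eq_row {β : ℝ} (hβ : β ≠ 0) (hN : 2 * M ≤ N) (p : FreqMomentum L M × Fin 2 → ℂ) (U : ℝ)
    (n : MatsubaraIdx M) (σ : Fin 2) (p₀ o : GridPoint L N) (y : TorusSite 2 L) :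
    (∑ p₁ : GridPoint L N, if p₁.2 = p₀.2 + y then
      Complex.exp (((matsubaraFreq β M n * (gridTime β N p₀.1 - gridTime β N p₁.1) : ℝ) : ℂ) * Complex.I) *
        kernel ℂ (effAction ℂ ((hubbardGridSub L M β N).transpose * normalCovariance L M p * hubbardGridSub L M β N)
          (hubbardGridInteraction L N β U)) 2 (fun i => ((![p₀, p₁] i, σ), i))
      else 0) =
    ∑ p₁ : GridPoint L N, if p₁.2 = o.2 + y then
      Complex.exp (((matsubaraFreq β M n * (gridTime β N o.1 - gridTime β N p₁.1) : ℝ) : ℂ) * Complex.I) *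
        kernel ℂ (effAction ℂ ((hubbardGridSub L M β N).transpose * normalCovariance L M p * hubbardGridSub L M β N)
          (hubbardGridInteraction L N β U)) 2 (fun i => ((![o, p₁] i, σ), i))
      else 0 := by
  classical
  set W := effAction ℂ ((hubbardGridSub L M β N).transpose * normalCovariance L M p * hubbardGridSub L M β N) (hubbardGridInteraction L N β U)
    with hW
  set t : GridPoint L N := p₀ - o with ht
  have hp₀ : p₀ = o + t := by rw [ht]; abel
  -- reindex the left sum by `p₁ = q + t`
  rw [← Equiv.sum_comp (Equiv.addRight t)]
  refine Finset.sum_congr rfl fun q _ => ?_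
  simp only [Equiv.coe_addRight]
  have hcond : ((q + t).2 = p₀.2 + y) ↔ (q.2 = o.2 + y) := by
    rw [hp₀, Prod.snd_add, Prod.snd_add]
    constructor
    · intro h; have := congrArg (· - t.2) h; simp at this; rw [this]; abel
    · intro h; rw [h]; abel
  by_cases hq : q.2 = o.2 + y
  · rw [if_pos (hcond.2 hq), if_pos hq, hp₀, Prod.fst_add, Prod.fst_add, exp_matsubara_gridTime_shift hβ n o.1 q.1 t.1]
    -- the kernel at the shifted pair
    have hker := kernel_gridEffAction_shift hβ hN p U t 2 (fun i => ((![o, q] i, σ), i))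
    rw [← hW] at hker
    have hfun : (fun i : Fin 2 => ((![o + t, q + t] i, σ), i)) =
        fun i => ((((fun i : Fin 2 => ((![o, q] i, σ), i)) i).1.1 + t, ((fun i : Fin 2 => ((![o, q] i, σ), i)) i).1.2),
          ((fun i : Fin 2 => ((![o, q] i, σ), i)) i).2) := by
      funext i; fin_cases i <;> rfl
    rw [hfun, hker, Fin.prod_univ_two]
    simp only [Matrix.cons_val_zero, Matrix.cons_val_one]
    have h1 : ∀ P : Prop, ∀ [Decidable P], ((if P then (1 : ℂ) else -1) * (if P then (1 : ℂ) else -1)) = 1 := by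
      intro P _; split_ifs <;> norm_num
    calc (if o.1.val + t.1.val < N then (1 : ℂ) else -1) * (if q.1.val + t.1.val < N then (1 : ℂ) else -1) *
          Complex.exp (((matsubaraFreq β M n * (gridTime β N o.1 - gridTime β N q.1) : ℝ) : ℂ) * Complex.I) *
          ((if o.1.val + t.1.val < N then (1 : ℂ) else -1) * (if q.1.val + t.1.val < N then (1 : ℂ) else -1) * kernel ℂ W 2 (fun i => ((![o, q] i, σ), i)))
        = ((if o.1.val + t.1.val < N then (1 : ℂ) else -1) * (if o.1.val + t.1.val < N then (1 : ℂ) else -1)) *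
          ((if q.1.val + t.1.val < N then (1 : ℂ) else -1) * (if q.1.val + t.1.val < N then (1 : ℂ) else -1)) *
          (Complex.exp (((matsubaraFreq β M n * (gridTime β N o.1 - gridTime β N q.1) : ℝ) : ℂ) * Complex.I) *
            kernel ℂ W 2 (fun i => ((![o, q] i, σ), i))) := by ring
      _ = _ := by rw [h1, h1, one_mul, one_mul]
  · rw [if_neg (fun h => hq (hcond.1 h)), if_neg hq]

end Summit.HubbardSuperconductivity.HubbardSuperconductivity.Theorems.TwoVolumeDefect

end
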